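import Literature.MathematicalPhysics.QuantumFieldTheory.PeriodicBoxRotation
import Literature.MathematicalPhysics.QuantumFieldTheory.PlaqSystemLocalIso
import HarnessLib

/-!
# Crux `IR` (stmt-QuantumFields-19354) — purity-channel family: towards the located supplier `ComplexAnchor`
# Part 1: general plaquette factors — locality, transport along local isomorphisms, the Kotecký–Preiss tail

Helper module for item `stmt-QuantumFields-19354` (`--supports … --as helper`; closes nothing, asserts nothing new).

The located supplier `PurityChannelFamily.ComplexAnchor` of the purity-channel family of lines
(`Theorems/IR/PurityChannelDefs.lean`, p638853; seams p639233 / p639500) asks for the Kotecký–Preiss control of the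
cold-torus partition function `Z[w](L³×⌊L/4⌋)` and of the purity ratio `h_L[w] = Z(2t)/Z(t)²` for an ARBITRARY continuous
complex plaquette weight `w` with `‖w − 1‖∞ ≤ ε₀`.  The tree's strong-coupling tube chain
(`PeriodicBoxRotation` → `PeriodicBoxRooting` → `PeriodicBoxInclusion` → `PeriodicBoxFreeEnergy`, all on top of the
GENERAL layer `IsLocalPerturbation` / `pertLogZ` of `Literature.Probability.LatticeModels.LocalPerturbation*`) is written
for the complex WILSON weight `exp(−z s_p) − 1` of a `PlaqSystem`.  This file and its sequels redo that chain for GENERAL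
cell factors `f p : ZdGaugeConfig d G → ℂ` attached to the labels of an abstract plaquette system `S : PlaqSystem d G ι`
(only `S.bonds` / `S.Adj` / `S.near` are used — never `S.cost`):

* §1 `isLocalPerturbation_of_factors`: measurable factors depending only on the bonds of their label and bounded by `ε`
  form an `IsLocalPerturbation` of the Haar product `zdHaar d G` for the adjacency `S.Adj` (verbatim the tree's
  `PlaqSystem.isLocalPerturbation` with the weight-specific lines replaced by hypotheses);
* §2 transport along a local isomorphism `φ : ι → ι'` on a label set `A` (bond relabelling `g`, hypotheses `h1 h2 h4` of
  `PlaqSystemLocalIso` and the factor transport `f' (φ p) U = f p (U ∘ g)`): `cellActivity`, `connActivity` and the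
  truncated functional `Φ^T` are transported (`…_of_transport`; the tree's `zPol_image_eq` / `connActivity_image_eq` /
  `truncatedWeight_image_image_eq`);
* §3 the periodic box: rotation-covariant factors have rotation-invariant `Φ^T` (`truncatedWeight_rotFamily_of_covariant`,
  the tree's `truncatedWeight_rotFamily`);
* §4 the Kotecký–Preiss tail for a general local perturbation on a finite cell type under the two-weight smallness
  `e² ε (Δ+1)² ≤ 1/2`: clusters of total size `≥ m` weigh at most `#W e^{−m}`, whence the truncated cluster expansion
  `‖log Z(W) − Σ_{Σ#Y<m} Φ^T‖ ≤ #W e^{−m}` (the tree's `PlaqSystem.sum_norm_truncatedWeight_large_le` /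
  `norm_pertLogZ_sub_sum_small_le`, stated at the `IsLocalPerturbation` level).

Everything is proved; no definitions; no named facts.  Sources: E. Seiler, LNP 159 (1982) Ch. 2–3; K. Osterwalder,
E. Seiler, Ann. Phys. 110 (1978) §3; R. Kotecký, D. Preiss, CMP 103 (1986) Theorem p. 492 with (1), (2), (4).

HONEST FRAMING: strong-coupling / small-activity bookkeeping, group-blind; width 0 toward `IR` (19354); nothing here bears on
confinement, a lattice gap or the Yang–Mills mass gap (Clay), which are NOT proved; `R4` closes only the conditional
finite-𝕋⁴ rung `BalabanLadder.UV`.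
-/

set_option autoImplicit false

noncomputable section

open MeasureTheory ProbabilityTheory Finset Filter
open Literature.Probability.LatticeModels
open Literature.MathematicalPhysics.QuantumFieldTheory

namespace Summit.QuantumFields.YangMills.Cruxes.IR.PurityChannelFamily

/-! ## §1 General plaquette factors are local perturbations of the Haar product -/

section LocalPerturbation

variable {d : ℕ} {G : Type*} {ι : Type*} {S : PlaqSystem d G ι}
  [Group G] [TopologicalSpace G] [IsTopologicalGroup G] [CompactSpace G] [MeasurableSpace G] [BorelSpace G]
  {f : ι → ZdGaugeConfig d G → ℂ} {ε : ℝ}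

/-- **General plaquette factors are a local perturbation of the Haar product.**  If every factor `f p` is measurable,
depends only on the bond variables of `p` and is bounded by `ε ≥ 0`, then `f` is an `IsLocalPerturbation` of
`ν = zdHaar d G` for the adjacency `S.Adj` (sharing a bond) with the σ-algebras generated by the bond variables of each
label: non-touching label sets have disjoint bond sets and generate independent σ-algebras under the product measure
(the tree's `PlaqSystem.isLocalPerturbation`, weight-free form).  [Osterwalder–Seiler 1978 §3; Seiler LNP 159 Ch. 3] -/
theorem isLocalPerturbation_of_factors (hε : 0 ≤ ε) (hmeas : ∀ p, Measurable (f p))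
    (hdep : ∀ p, DependsOn (f p) ((S.bonds p : Finset (ZdEdge d)) : Set (ZdEdge d)))
    (hnorm : ∀ p U, ‖f p U‖ ≤ ε) :
    IsLocalPerturbation (zdHaar d G) S.Adj
      (fun p => ⨆ e ∈ S.bonds p, MeasurableSpace.comap (fun U : ZdGaugeConfig d G => U e)
        ‹MeasurableSpace G›)
      f ε where
  le p := iSup₂_le fun e _ => (measurable_pi_apply e).comap_le
  indep K₁ K₂ hK := by
    classical
    have hK' : ¬ _root_.Literature.Probability.LatticeModels.Touches (ShareVertex S.bonds) K₁ K₂ :=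
      fun h => hK (PlaqSystem.touches_shareVertex_bonds_iff.1 h)
    have h := IsLocalPerturbation.indep_of_iIndep (μ := zdHaar d G)
      (m := fun e : ZdEdge d => MeasurableSpace.comap (fun U : ZdGaugeConfig d G => U e)
        ‹MeasurableSpace G›)
      (fun e => (measurable_pi_apply e).comap_le) (PlaqSystem.iIndep_comap_eval (d := d) (G := G)) S.bonds
      S.bonds_nonempty K₁ K₂ hK'
    exact h
  measurable p := PlaqSystem.measurable_local_of_dependsOn (hmeas p) (hdep p)
  norm_le p U := hnorm p U
  nonneg := hε

omit [Group G] [TopologicalSpace G] [IsTopologicalGroup G] [CompactSpace G] [BorelSpace G] in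
/-- Products of measurable factors are measurable. [folklore] -/
theorem measurable_prod_factors (hmeas : ∀ p, Measurable (f p)) (Y : Finset ι) :
    Measurable fun U : ZdGaugeConfig d G => ∏ p ∈ Y, f p U :=
  Finset.measurable_prod Y fun p _ => hmeas p

omit [TopologicalSpace G] [IsTopologicalGroup G] [CompactSpace G] [MeasurableSpace G] [BorelSpace G] [Group G] in
/-- A product of factors over `Y` depends only on the bonds of the labels of `Y`. [folklore] -/
theorem dependsOn_prod_factors [DecidableEq ι]
    (hdep : ∀ p, DependsOn (f p) ((S.bonds p : Finset (ZdEdge d)) : Set (ZdEdge d))) (Y : Finset ι) :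
    DependsOn (fun U : ZdGaugeConfig d G => ∏ p ∈ Y, f p U)
      ((Y.biUnion S.bonds : Finset (ZdEdge d)) : Set (ZdEdge d)) := by
  intro U V h
  refine Finset.prod_congr rfl fun p hp => hdep p fun e he => h e ?_
  exact Finset.mem_coe.2 (Finset.mem_biUnion.2 ⟨p, hp, Finset.mem_coe.1 he⟩)

end LocalPerturbation

/-! ## §2 Transport of activities and of the truncated functional along a local isomorphism -/

section Transport

variable {d : ℕ} {G : Type*} {ι ι' : Type*} [DecidableEq ι] [DecidableEq ι']
  {S : PlaqSystem d G ι} {S' : PlaqSystem d G ι'} {φ : ι → ι'} {g : ZdEdge d → ZdEdge d} {A : Finset ι}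
  [Group G] [TopologicalSpace G] [IsTopologicalGroup G] [CompactSpace G] [MeasurableSpace G] [BorelSpace G]
  {f : ι → ZdGaugeConfig d G → ℂ} {f' : ι' → ZdGaugeConfig d G → ℂ}

/-- **Cell-set activities are transported**: if `f' (φ p) U = f p (U ∘ g)` for `p ∈ A`, `g` is injective on the bonds of
`A` and `φ` is injective on `A`, then `M'(φ Y) = M(Y)` for `Y ⊆ A` (relabelling invariance of the Haar product, the
tree's `integral_comp_eq_of_dependsOn_injOn`; weight-free form of `PlaqSystem.zPol_image_eq`). [Seiler LNP 159 Ch. 2] -/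
theorem cellActivity_image_eq_of_transport (h2 : Set.InjOn g (↑(A.biUnion S.bonds) : Set (ZdEdge d)))
    (h3 : ∀ p ∈ A, ∀ U : ZdGaugeConfig d G, f' (φ p) U = f p (U ∘ g)) (h4 : Set.InjOn φ A)
    (hmeas : ∀ p, Measurable (f p))
    (hdep : ∀ p, DependsOn (f p) ((S.bonds p : Finset (ZdEdge d)) : Set (ZdEdge d)))
    {Y : Finset ι} (hY : Y ⊆ A) :
    cellActivity (zdHaar d G) f' (Y.image φ) = cellActivity (zdHaar d G) f Y := by
  unfold cellActivity
  have hprod : ∀ U : ZdGaugeConfig d G, ∏ p ∈ Y.image φ, f' p U = ∏ p ∈ Y, f p (U ∘ g) := by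
    intro U
    rw [Finset.prod_image fun a ha b hb h => h4 (hY ha) (hY hb) h]
    exact Finset.prod_congr rfl fun p hp => h3 p (hY hp) U
  simp_rw [hprod]
  exact integral_comp_eq_of_dependsOn_injOn (measurable_prod_factors hmeas Y) (dependsOn_prod_factors hdep Y)
    (h2.mono (Finset.coe_subset.2 (Finset.biUnion_subset_biUnion_of_subset_left _ hY)))

/-- **The polymer functional is transported**: under the hypotheses `h1`–`h4` of a local isomorphism on `A` (bonds,
bond-injectivity, factor transport, label-injectivity) the `connActivity` of `f'` at `φ Y` is that of `f` at `Y`, for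
`Y ⊆ A` (weight-free form of `PlaqSystem.connActivity_image_eq`). [Seiler LNP 159 Ch. 2] -/
theorem connActivity_image_eq_of_transport (h1 : ∀ p ∈ A, S'.bonds (φ p) = (S.bonds p).image g)
    (h2 : Set.InjOn g (↑(A.biUnion S.bonds) : Set (ZdEdge d)))
    (h3 : ∀ p ∈ A, ∀ U : ZdGaugeConfig d G, f' (φ p) U = f p (U ∘ g)) (h4 : Set.InjOn φ A)
    (hmeas : ∀ p, Measurable (f p))
    (hdep : ∀ p, DependsOn (f p) ((S.bonds p : Finset (ZdEdge d)) : Set (ZdEdge d)))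
    {Y : Finset ι} (hY : Y ⊆ A) :
    connActivity S'.Adj (zdHaar d G) f' (Y.image φ) = connActivity S.Adj (zdHaar d G) f Y := by
  by_cases hc : IsRConnected S.Adj Y
  · have hc' : IsRConnected S'.Adj (Y.image φ) := (PlaqSystem.isRConnected_image_iff h1 h2 h4 hY).2 hc
    simp only [connActivity, hc, hc', if_true]
    exact cellActivity_image_eq_of_transport h2 h3 h4 hmeas hdep hY
  · have hc' : ¬ IsRConnected S'.Adj (Y.image φ) := fun h =>
      hc ((PlaqSystem.isRConnected_image_iff h1 h2 h4 hY).1 h)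
    simp only [connActivity, hc, hc', if_false]

/-- **The truncated functional is transported**: for a finite family `𝒞` of polymers supported in `A`,
`Φ'^T(φ 𝒞) = Φ^T(𝒞)` (the tree's `truncatedWeight_image`; weight-free form of
`PlaqSystem.truncatedWeight_image_image_eq`). [Kotecký–Preiss 1986 §2] -/
theorem truncatedWeight_image_image_eq_of_transport (h1 : ∀ p ∈ A, S'.bonds (φ p) = (S.bonds p).image g)
    (h2 : Set.InjOn g (↑(A.biUnion S.bonds) : Set (ZdEdge d)))
    (h3 : ∀ p ∈ A, ∀ U : ZdGaugeConfig d G, f' (φ p) U = f p (U ∘ g)) (h4 : Set.InjOn φ A)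
    (hmeas : ∀ p, Measurable (f p))
    (hdep : ∀ p, DependsOn (f p) ((S.bonds p : Finset (ZdEdge d)) : Set (ZdEdge d)))
    {𝒞 : Finset (Finset ι)} (h𝒞 : ∀ Y ∈ 𝒞, Y ⊆ A) :
    truncatedWeight (GeomInc S'.Adj) (connActivity S'.Adj (zdHaar d G) f') (𝒞.image (Finset.image φ)) =
      truncatedWeight (GeomInc S.Adj) (connActivity S.Adj (zdHaar d G) f) 𝒞 :=
  truncatedWeight_image (injOn_image_of_injOn h4 h𝒞)
    (fun Y hY Y' hY' => PlaqSystem.geomInc_image_iff h1 h2 h4 (h𝒞 Y hY) (h𝒞 Y' hY'))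
    fun Y hY => connActivity_image_eq_of_transport h1 h2 h3 h4 hmeas hdep (h𝒞 Y hY)

end Transport

/-! ## §3 The periodic box: rotation-covariant factors have rotation-invariant truncated functionals -/

section BoxRotation

variable {d : ℕ} {n : Fin d → ℕ} {G : Type*} [Group G] {N : ℕ} {ρ : G →* Matrix (Fin N) (Fin N) ℂ}
  [TopologicalSpace G] [IsTopologicalGroup G] [CompactSpace G] [MeasurableSpace G] [BorelSpace G]
  {f : BoxLabel n → ZdGaugeConfig d G → ℂ}

/-- **Rotation invariance of `Φ^T` for rotation-covariant factors on the periodic box.**  If the factors of the box labels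
are measurable, depend only on the bonds of their label, and transform under the translation `rot i s` in the `i`-th
coordinate as `f (rot i s p) U = f p (U ∘ boxEdgeRot n i s)`, then `Φ^T(rot 𝒞) = Φ^T(𝒞)` for every finite family of
polymers of the box system `boxSystem ρ n` (only its bonds/adjacency enter; the tree's `truncatedWeight_rotFamily` is the
Wilson-weight instance). [Seiler LNP 159 Ch. 2] -/
theorem truncatedWeight_rotFamily_of_covariant (hmeas : ∀ p, Measurable (f p))
    (hdep : ∀ p : BoxLabel n, DependsOn (f p) ((p.bonds : Finset (ZdEdge d)) : Set (ZdEdge d)))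
    (i : Fin d) (s : ℕ)
    (hrot : ∀ (p : BoxLabel n) (U : ZdGaugeConfig d G), f (BoxLabel.rot i s p) U = f p (U ∘ boxEdgeRot n i s))
    (𝒞 : Finset (Finset (BoxLabel n))) :
    truncatedWeight (GeomInc (boxSystem (G := G) ρ n).Adj)
        (connActivity (boxSystem (G := G) ρ n).Adj (zdHaar d G) f) (𝒞.image (Finset.image (BoxLabel.rot i s))) =
      truncatedWeight (GeomInc (boxSystem (G := G) ρ n).Adj)
        (connActivity (boxSystem (G := G) ρ n).Adj (zdHaar d G) f) 𝒞 := by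
  classical
  exact truncatedWeight_image_image_eq_of_transport (S := boxSystem (G := G) ρ n) (S' := boxSystem (G := G) ρ n)
    (A := Finset.univ) (fun p _ => BoxLabel.bonds_rot i s p) (injOn_boxEdgeRot i s _)
    (fun p _ U => hrot p U) (BoxLabel.rot_injective i s).injOn hmeas hdep (fun _ _ => Finset.subset_univ _)

omit [TopologicalSpace G] [IsTopologicalGroup G] [CompactSpace G] [MeasurableSpace G] [BorelSpace G] in
/-- The degree bound of the box system, without reference to the costs: at most `boxDeg d = 16 d²` labels share a bond with
a given one. [folklore] -/
theorem card_near_boxSystem_le (p : BoxLabel n) : ((boxSystem (G := G) ρ n).near p).card ≤ boxDeg d := by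
  classical
  show (Finset.univ.filter fun q => ¬ Disjoint p.bonds (BoxLabel.bonds q)).card ≤ boxDeg d
  convert card_filter_not_disjoint_bonds_le p

end BoxRotation

/-! ## §4 The Kotecký–Preiss tail of the cluster expansion for a general local perturbation -/

section Tail

variable {V : Type*} [DecidableEq V] [Fintype V] {Ω : Type*} {mΩ : MeasurableSpace Ω} {μ : Measure Ω}
  [IsProbabilityMeasure μ] {R : V → V → Prop} [DecidableRel R] [Std.Symm R] {𝓕 : V → MeasurableSpace Ω}
  {f : V → Ω → ℂ} {ε : ℝ} {nbr : V → Finset V} {Δ : ℕ}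

/-- From the two-weight smallness `e² ε (Δ+1)² ≤ 1/2` to the Dobrushin smallness `e ε (Δ+1)² ≤ 1/2` (the tree's
`PlaqSystem.smallness_one_of_two`, restated for convenience). [folklore] -/
theorem smallness_one_of_two' (hε : 0 ≤ ε) (h : Real.exp 2 * ε * ((Δ : ℝ) + 1) ^ 2 ≤ 1 / 2) :
    Real.exp 1 * ε * ((Δ : ℝ) + 1) ^ 2 ≤ 1 / 2 :=
  PlaqSystem.smallness_one_of_two (D := Δ) hε h

/-- The Kotecký–Preiss hypothesis (1) with `a(Y) = d(Y) = #Y` for the polymer functional of a local perturbation on a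
finite cell type, on the disc `e² ε (Δ+1)² ≤ 1/2` (a finite-sum condition: the tree's animal bound `geomInc_kp_sum_le` with
`τ = 1`; general-factor form of `PlaqSystem.kp_hypothesis_card_card`). [Kotecký–Preiss 1986, (1)] -/
theorem kp_hypothesis_card_card_of_local (hΔ : ∀ x, (nbr x).card ≤ Δ) (hnbr : ∀ x y, R x y → y ∈ nbr x)
    (h : IsLocalPerturbation μ R 𝓕 f ε) (hsmall : Real.exp 2 * ε * ((Δ : ℝ) + 1) ^ 2 ≤ 1 / 2) (γ : Finset V) :
    Summable (fun γ' : {γ' : Finset V // GeomInc R γ' γ} =>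
        ‖connActivity R μ f γ'‖ *
          Real.exp ((fun Y : Finset V => (Y.card : ℝ)) γ' + (fun Y : Finset V => (Y.card : ℝ)) γ')) ∧
      ∑' γ' : {γ' : Finset V // GeomInc R γ' γ},
        ‖connActivity R μ f γ'‖ *
          Real.exp ((fun Y : Finset V => (Y.card : ℝ)) γ' + (fun Y : Finset V => (Y.card : ℝ)) γ') ≤
        (fun Y : Finset V => (Y.card : ℝ)) γ := by
  classical
  have hε : 0 ≤ ε := h.nonneg
  set w := connActivity R μ f with hw
  have hz0 : ∀ X, ¬ IsRConnected R X → w X = 0 := fun X hX => by simp [hw, connActivity, hX]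
  have hz : ∀ X, ‖w X‖ ≤ ε ^ X.card := fun X => by
    by_cases hX : IsRConnected R X
    · simpa [hw, connActivity, hX] using norm_cellActivity_le h X
    · simp only [hw, connActivity, hX, if_false, norm_zero]; exact pow_nonneg hε _
  have hs : Real.exp (1 + 1) * ε * ((Δ : ℝ) + 1) ^ 2 ≤ 1 / 2 := by
    rw [show (1 : ℝ) + 1 = 2 by norm_num]; exact hsmall
  have hfin : ∀ γ : Finset V, ∑ γ' ∈ Finset.univ with GeomInc R γ' γ,
      ‖w γ'‖ * Real.exp ((fun Y : Finset V => (Y.card : ℝ)) γ' + (fun Y : Finset V => (Y.card : ℝ)) γ') ≤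
        (fun Y : Finset V => (Y.card : ℝ)) γ := by
    intro γ
    have h' := geomInc_kp_sum_le (symm_of_inst (R := R)) hΔ hnbr hε hs w hz0 hz γ
      (Finset.univ.filter fun Y => GeomInc R Y γ) fun Y hY => (Finset.mem_filter.1 hY).2
    have h2 := two_mul_exp_mul_le_one hε hs
    simp only [one_mul] at h'
    calc ∑ γ' ∈ Finset.univ with GeomInc R γ' γ, ‖w γ'‖ * Real.exp ((γ'.card : ℝ) + (γ'.card : ℝ))
        ≤ (γ.card : ℝ) * ((Δ : ℝ) + 1) * (2 * (Real.exp (1 + 1) * ε)) := h'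
      _ = γ.card * (((Δ : ℝ) + 1) * (2 * (Real.exp (1 + 1) * ε))) := by ring
      _ ≤ γ.card * 1 := mul_le_mul_of_nonneg_left h2 (Nat.cast_nonneg _)
      _ = γ.card := mul_one _
  exact kp_hypothesis_of_fintype (inc := GeomInc R) (w := w)
    (a := fun Y : Finset V => (Y.card : ℝ)) (d := fun Y : Finset V => (Y.card : ℝ)) hfin γ

/-- **The tail of the cluster expansion for a general local perturbation.**  On the disc `e² ε (Δ+1)² ≤ 1/2` the clusters
of polymers of `W` of total size `Σ_{Y ∈ 𝒞} #Y ≥ m` have total truncated weight at most `#W · e^{−m}`: every such nonempty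
family touches a singleton `{p}`, `p ∈ W`, and by the Kotecký–Preiss estimate (4) with decay weight `d(Y) = #Y` the
families through `{p}` of `d`-size `≥ m` weigh at most `e^{−m} a({p}) = e^{−m}` (general-factor form of
`PlaqSystem.sum_norm_truncatedWeight_large_le`). [Kotecký–Preiss 1986, Theorem p. 492, estimate (4)] -/
theorem sum_norm_truncatedWeight_large_le_of_local (hΔ : ∀ x, (nbr x).card ≤ Δ)
    (hnbr : ∀ x y, R x y → y ∈ nbr x) (h : IsLocalPerturbation μ R 𝓕 f ε)
    (hsmall : Real.exp 2 * ε * ((Δ : ℝ) + 1) ^ 2 ≤ 1 / 2) (W : Finset V) (m : ℕ) :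
    ∑ 𝒞 ∈ (rconnSubsets R W).powerset with (m : ℝ) ≤ ∑ Y ∈ 𝒞, (Y.card : ℝ),
        ‖truncatedWeight (GeomInc R) (connActivity R μ f) 𝒞‖ ≤
      W.card * Real.exp (-(m : ℝ)) := by
  classical
  set L := rconnSubsets R W with hL
  set w := connActivity R μ f with hw
  set Φ : Finset (Finset V) → ℂ := truncatedWeight (GeomInc R) w with hΦ
  set 𝒜 : Finset (Finset (Finset V)) := L.powerset.filter fun 𝒞 => (m : ℝ) ≤ ∑ Y ∈ 𝒞, (Y.card : ℝ)
    with h𝒜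
  have ha : ∀ Y : Finset V, 0 ≤ (fun Y : Finset V => (Y.card : ℝ)) Y := fun _ => Nat.cast_nonneg _
  have hfact := koteckyPreiss_truncatedWeight_bound_holds (GeomInc R) w
    (fun Y : Finset V => (Y.card : ℝ)) (fun Y : Finset V => (Y.card : ℝ))
  have h1 := kp_hypothesis_card_card_of_local hΔ hnbr h hsmall
  -- pin every nonempty family at a singleton `{p}`, `p ∈ W`
  have hpin : ∀ 𝒞 ∈ 𝒜, ‖Φ 𝒞‖ ≤ ∑ p ∈ W with KPTouches (GeomInc R) 𝒞 {p}, ‖Φ 𝒞‖ := by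
    intro 𝒞 h𝒞
    obtain ⟨h𝒞L, -⟩ := Finset.mem_filter.1 h𝒞
    rcases 𝒞.eq_empty_or_nonempty with rfl | hne
    · exact le_of_eq_of_le (by rw [hΦ, truncatedWeight_empty, norm_zero])
        (Finset.sum_nonneg fun _ _ => norm_nonneg _)
    · obtain ⟨p, hpW, hp⟩ := exists_kpTouches_singleton (Finset.mem_powerset.1 h𝒞L) hne
      have hmem : p ∈ W.filter fun p => KPTouches (GeomInc R) 𝒞 {p} := Finset.mem_filter.2 ⟨hpW, hp⟩
      calc ‖Φ 𝒞‖ = ∑ q ∈ ({p} : Finset V), ‖Φ 𝒞‖ := by simp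
        _ ≤ _ := Finset.sum_le_sum_of_subset_of_nonneg (by simpa using hmem) fun _ _ _ => norm_nonneg _
  calc ∑ 𝒞 ∈ 𝒜, ‖Φ 𝒞‖
      ≤ ∑ 𝒞 ∈ 𝒜, ∑ p ∈ W with KPTouches (GeomInc R) 𝒞 {p}, ‖Φ 𝒞‖ := Finset.sum_le_sum hpin
    _ = ∑ p ∈ W, ∑ 𝒞 ∈ 𝒜 with KPTouches (GeomInc R) 𝒞 {p}, ‖Φ 𝒞‖ := by
        rw [Finset.sum_comm' (t' := W) (s' := fun p => 𝒜.filter fun 𝒞 => KPTouches (GeomInc R) 𝒞 {p})]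
        intro 𝒞 p
        simp only [Finset.mem_filter]
        tauto
    _ ≤ ∑ p ∈ W, Real.exp (-(m : ℝ)) * (({p} : Finset V).card : ℝ) := by
        refine Finset.sum_le_sum fun p _ => ?_
        refine sum_norm_truncatedWeight_le_exp_neg_of_touches hfact ha ha h1 𝒜 {p} fun 𝒞 h𝒞 _ => ?_
        exact (Finset.mem_filter.1 h𝒞).2
    _ = W.card * Real.exp (-(m : ℝ)) := by
        simp only [Finset.card_singleton, Nat.cast_one, mul_one, Finset.sum_const, nsmul_eq_mul]

/-- **The truncated cluster expansion of `log Z` for a general local perturbation.**  On the disc `e² ε (Δ+1)² ≤ 1/2`: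
`‖log Z(W) − Σ_{𝒞 ⊆ 𝒫(W), Σ #Y < m} Φ^T(𝒞)‖ ≤ #W · e^{−m}` (general-factor form of
`PlaqSystem.norm_pertLogZ_sub_sum_small_le`). [Kotecký–Preiss 1986, Theorem p. 492, (2) and (4)] -/
theorem norm_pertLogZ_sub_sum_small_le_of_local (hΔ : ∀ x, (nbr x).card ≤ Δ)
    (hnbr : ∀ x y, R x y → y ∈ nbr x) (h : IsLocalPerturbation μ R 𝓕 f ε)
    (hsmall : Real.exp 2 * ε * ((Δ : ℝ) + 1) ^ 2 ≤ 1 / 2) (W : Finset V) (m : ℕ) :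
    ‖pertLogZ μ f R W -
        ∑ 𝒞 ∈ (rconnSubsets R W).powerset with ∑ Y ∈ 𝒞, (Y.card : ℝ) < m,
          truncatedWeight (GeomInc R) (connActivity R μ f) 𝒞‖ ≤
      W.card * Real.exp (-(m : ℝ)) := by
  classical
  rw [pertLogZ_eq_sum_truncatedWeight, ← Finset.sum_filter_add_sum_filter_not (rconnSubsets R W).powerset
    (fun 𝒞 => ∑ Y ∈ 𝒞, (Y.card : ℝ) < m), add_sub_cancel_left]
  refine (norm_sum_le _ _).trans ?_
  have hset : (rconnSubsets R W).powerset.filter (fun 𝒞 => ¬ ∑ Y ∈ 𝒞, (Y.card : ℝ) < m) =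
      (rconnSubsets R W).powerset.filter fun 𝒞 => (m : ℝ) ≤ ∑ Y ∈ 𝒞, (Y.card : ℝ) := by
    simp only [not_lt]
  rw [hset]
  exact sum_norm_truncatedWeight_large_le_of_local hΔ hnbr h hsmall W m

end Tail

end Summit.QuantumFields.YangMills.Cruxes.IR.PurityChannelFamily

end
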